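import Mathlib
import Summits.QuantumAdvantage.QuantumAdvantage.Theses.LinnikCubicClassGroups
import Literature.Computability.Cryptography.ShorStepFP
import HarnessLib

/-!
# `stub_reach` of line `JuntaLadder` (crux `PureCubicClassNumberHard`, stmt-QuantumAdvantage-11826): 48 free bit positions reach every residue modulo `49`

Crux `stmt-QuantumAdvantage-11826` (route `LinnikCubicClassGroups`, rank-0 hypothesis-type target
`X = PureCubicClassNumberHard`), line `JuntaLadder`
(`Cruxes/PureCubicClassNumberHard/Lines/JuntaLadder.lean`, forward ladder generator G4), registered
stub `stub_reach : ReachSevenMod49`, proved here with the statement unfolded verbatim: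

> from `encodeNat m` (`m > 0`), changing bits only inside a set `F` of at least `48` NON-TOP
> positions reaches an input of the same length decoding to `≡ 7 (mod 49)`.

Proof.  The positions `i ∈ F` carry the weights `2^i`, which are units modulo `49`; the subset sums
of `k` units of `ℤ/Nℤ` cover at least `min(N, k+1)` residues (Chowla's form of the
Cauchy–Davenport step: translating a proper non-empty set of residues by a unit, an additive
generator, cannot fix it), so `48` positions reach all `49` residues; and an equal-length bit string
with the (untouched) top bit `true` is a canonical numeral, whose `decodeNat` is its binary value.

* `exists_nsmul_eq_of_isUnit`, `card_union_image_add_ge`, `min_le_card_subsetSums`,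
  `exists_subset_sum_eq_of_isUnit` — the covering lemma in `ZMod N`;
* `decodeNat_eq_bitsToNat_append_true` — `decodeNat` of a canonical numeral is its binary value
  (with the tree's `ShorFP.bitsToNat_ofFn` for `ofFn` strings);
* `stub_reach` — the registered stub (`ReachSevenMod49` of the line file, unfolded).

HONEST FRAMING (block-2b rule): the value here is a closed registered stub (a kernel-checked
combinatorial lemma), NOT summit progress; the crux itself is hypothesis-type.

References: S. Chowla, *A theorem on the addition of residue classes*, Proc. Indian Acad. Sci. 2
(1935) 242–243 (Cauchy–Davenport with unit summands modulo a composite); folklore.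
-/

namespace Summit.QuantumAdvantage.QuantumAdvantage.Theorems.LinnikCubicClassGroups

open Literature.Computability.Complexity _root_.Computability
open Literature.Computability.Cryptography.ShorFP (bitsToNat_ofFn)

/-! ### Subset sums of units cover `ℤ/Nℤ` -/

/-- A unit of `ZMod N` is an additive generator: every residue is a natural multiple of it.
[folklore] -/
theorem exists_nsmul_eq_of_isUnit {N : ℕ} [NeZero N] {u : ZMod N} (hu : IsUnit u) (y : ZMod N) :
    ∃ k : ℕ, k • u = y := by
  obtain ⟨v, rfl⟩ := hu
  refine ⟨(y * (v⁻¹ : (ZMod N)ˣ)).val, ?_⟩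
  rw [nsmul_eq_mul, ZMod.natCast_zmod_val, mul_assoc, Units.inv_mul, mul_one]

/-- **Chowla's step.**  Translating a finite set of residues `R ≠ ∅, univ` by a unit `u` of `ZMod N`
produces a new residue: `#(R ∪ (R + u)) ≥ #R + 1`. [cite: Chowla1935] [folklore] -/
theorem card_union_image_add_ge {N : ℕ} [NeZero N] (R : Finset (ZMod N)) (hR : R.Nonempty)
    (hRu : R ≠ Finset.univ) {u : ZMod N} (hu : IsUnit u) :
    R.card + 1 ≤ (R ∪ R.image (· + u)).card := by
  classical
  -- if `R + u ⊆ R` then `R` is stable under all multiples of `u`, hence everything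
  by_cases hsub : R.image (· + u) ⊆ R
  · exfalso
    apply hRu
    have hstab : ∀ (k : ℕ) (x : ZMod N), x ∈ R → x + k • u ∈ R := by
      intro k
      induction k with
      | zero => intro x hx; simpa using hx
      | succ k ih =>
        intro x hx
        have h1 : x + k • u + u ∈ R := hsub (Finset.mem_image.mpr ⟨x + k • u, ih x hx, rfl⟩)
        rwa [succ_nsmul, ← add_assoc]
    obtain ⟨x, hx⟩ := hR
    refine Finset.eq_univ_of_forall fun y => ?_
    obtain ⟨k, hk⟩ := exists_nsmul_eq_of_isUnit hu (y - x)
    have := hstab k x hx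
    rwa [hk, add_sub_cancel] at this
  · obtain ⟨y, hy, hyR⟩ := Finset.not_subset.mp hsub
    calc R.card + 1 = (insert y R).card := (Finset.card_insert_of_notMem hyR).symm
      _ ≤ (R ∪ R.image (· + u)).card :=
          Finset.card_le_card (Finset.insert_subset (Finset.mem_union_right _ hy)
            Finset.subset_union_left)

/-- **Subset sums of units.**  For a finite family of units `a i` (`i ∈ F`) of `ZMod N`, the subset
sums `∑_{i ∈ S} a i`, `S ⊆ F`, take at least `min (N, #F + 1)` values. [cite: Chowla1935] [folklore] -/
theorem min_le_card_subsetSums {N : ℕ} [NeZero N] {ι : Type*} [DecidableEq ι] (F : Finset ι)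
    (a : ι → ZMod N) (ha : ∀ i ∈ F, IsUnit (a i)) :
    min N (F.card + 1) ≤ (F.powerset.image fun S => ∑ i ∈ S, a i).card := by
  classical
  induction F using Finset.induction_on with
  | empty => simp
  | insert j F hj ih =>
    have haF : ∀ i ∈ F, IsUnit (a i) := fun i hi => ha i (Finset.mem_insert_of_mem hi)
    have hj' : IsUnit (a j) := ha j (Finset.mem_insert_self j F)
    set R : Finset (ZMod N) := F.powerset.image fun S => ∑ i ∈ S, a i with hRdef
    -- `R ∪ (R + a j) ⊆` subset sums of `insert j F`
    have hsub : R ∪ R.image (· + a j) ⊆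
        (insert j F).powerset.image fun S => ∑ i ∈ S, a i := by
      intro y hy
      rcases Finset.mem_union.mp hy with h | h
      · obtain ⟨S, hS, rfl⟩ := Finset.mem_image.mp h
        exact Finset.mem_image.mpr ⟨S, Finset.mem_powerset.mpr
          ((Finset.mem_powerset.mp hS).trans (Finset.subset_insert j F)), rfl⟩
      · obtain ⟨z, hz, rfl⟩ := Finset.mem_image.mp h
        obtain ⟨S, hS, rfl⟩ := Finset.mem_image.mp hz
        have hSF : S ⊆ F := Finset.mem_powerset.mp hS
        have hjS : j ∉ S := fun h => hj (hSF h)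
        refine Finset.mem_image.mpr ⟨insert j S, Finset.mem_powerset.mpr
          (Finset.insert_subset_insert j hSF), ?_⟩
        rw [Finset.sum_insert hjS, add_comm]
    have hRne : R.Nonempty := ⟨∑ i ∈ (∅ : Finset ι), a i,
      Finset.mem_image.mpr ⟨∅, Finset.mem_powerset.mpr (Finset.empty_subset F), rfl⟩⟩
    rw [Finset.card_insert_of_notMem hj]
    by_cases hRu : R = Finset.univ
    · -- already everything
      have hle : (Finset.univ : Finset (ZMod N)).card ≤
          ((insert j F).powerset.image fun S => ∑ i ∈ S, a i).card :=
        Finset.card_le_card (hRu ▸ (Finset.subset_union_left.trans hsub))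
      rw [Finset.card_univ, ZMod.card] at hle
      exact (min_le_left _ _).trans hle
    · have h1 := card_union_image_add_ge R hRne hRu hj'
      have h2 := Finset.card_le_card hsub
      have h3 : min N (F.card + 1) ≤ R.card := ih haF
      omega

/-- Hence `#F + 1 ≥ N` units reach EVERY residue as a subset sum. [cite: Chowla1935] [folklore] -/
theorem exists_subset_sum_eq_of_isUnit {N : ℕ} [NeZero N] {ι : Type*} [DecidableEq ι]
    (F : Finset ι) (a : ι → ZMod N) (ha : ∀ i ∈ F, IsUnit (a i)) (hF : N ≤ F.card + 1)
    (t : ZMod N) : ∃ S, S ⊆ F ∧ ∑ i ∈ S, a i = t := by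
  classical
  have hcard : N ≤ (F.powerset.image fun S => ∑ i ∈ S, a i).card :=
    (min_eq_left hF).symm.trans_le (min_le_card_subsetSums F a ha)
  have huniv : (F.powerset.image fun S => ∑ i ∈ S, a i) = Finset.univ :=
    Finset.eq_univ_of_card _ (le_antisymm (Finset.card_le_univ _) (by rw [ZMod.card]; exact hcard))
  have ht : t ∈ (F.powerset.image fun S => ∑ i ∈ S, a i) := huniv ▸ Finset.mem_univ t
  obtain ⟨S, hS, hsum⟩ := Finset.mem_image.mp ht
  exact ⟨S, Finset.mem_powerset.mp hS, hsum⟩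

/-! ### Binary values of bit strings -/

/-- Mathlib's `decodePosNum` on a string ending in `true` is its binary value. [folklore] -/
theorem decodePosNum_append_true_eq_bitsToNat : ∀ l : List Bool,
    ((decodePosNum (l ++ [true]) : PosNum) : ℕ) = bitsToNat (l ++ [true])
  | [] => by simp [decodePosNum, bitsToNat]
  | b :: l => by
    have ih := decodePosNum_append_true_eq_bitsToNat l
    have hne : l ++ [true] ≠ [] := by simp
    cases b
    · rw [List.cons_append, decodePosNum, PosNum.cast_bit0, ih, bitsToNat_cons]
      simp
      ring
    · rw [List.cons_append, decodePosNum, if_neg hne, PosNum.cast_bit1, ih, bitsToNat_cons]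
      simp
      ring

/-- `decodeNat` of a canonical numeral (a string ending in `true`) is its binary value. [folklore] -/
theorem decodeNat_eq_bitsToNat_append_true (l : List Bool) :
    decodeNat (l ++ [true]) = bitsToNat (l ++ [true]) := by
  have hne : l ++ [true] ≠ [] := by simp
  have h : decodeNum (l ++ [true]) = Num.pos (decodePosNum (l ++ [true])) := by
    simp [decodeNum, hne]
  show ((decodeNum (l ++ [true]) : Num) : ℕ) = bitsToNat (l ++ [true])
  rw [h]
  exact decodePosNum_append_true_eq_bitsToNat l

/-- `encodeNat m` for `m > 0` ends in `true`. [folklore] -/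
theorem exists_encodeNat_eq_append_true {m : ℕ} (hm : 0 < m) :
    ∃ v : List Bool, encodeNat m = v ++ [true] := by
  have key : ∀ k : PosNum, ∃ v, encodePosNum k = v ++ [true] := by
    intro k
    induction k with
    | one => exact ⟨[], rfl⟩
    | bit0 k ih => obtain ⟨v, hv⟩ := ih; exact ⟨false :: v, by simp [encodePosNum, hv]⟩
    | bit1 k ih => obtain ⟨v, hv⟩ := ih; exact ⟨true :: v, by simp [encodePosNum, hv]⟩
  unfold encodeNat encodeNum
  cases hn : (m : Num) with
  | zero =>
    exfalso
    have : ((m : Num) : ℕ) = 0 := by rw [hn]; rfl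
    rw [Num.to_of_nat] at this
    omega
  | pos k => exact key k

/-- Splitting off the last entry of `List.ofFn g`, `g : Fin n → α` with `n = n₀ + 1`. [folklore] -/
theorem ofFn_eq_append_last {α : Type*} {n n₀ : ℕ} (h : n = n₀ + 1) (g : Fin n → α) :
    List.ofFn g = List.ofFn (fun i : Fin n₀ => g (Fin.cast h.symm i.castSucc)) ++
      [g (Fin.cast h.symm (Fin.last n₀))] := by
  subst h
  rw [List.ofFn_succ']
  simp

/-! ### The stub -/

/-- **Registered stub `stub_reach` of line `JuntaLadder`** (`ReachSevenMod49` of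
`Cruxes/PureCubicClassNumberHard/Lines/JuntaLadder.lean`, unfolded verbatim): from `encodeNat m`
(`m > 0`), changing bits only inside a set `F` of at least `48` non-top positions reaches a string
of the same length decoding to `≡ 7 (mod 49)`.  (The weights `2^i`, `i ∈ F`, are units mod `49`,
so by `exists_subset_sum_eq_of_isUnit` some choice of the free bits adjusts the value to any
residue; the top bit is untouched, so the new string is still a canonical numeral.) [folklore] -/
theorem stub_reach : ∀ (m : ℕ) (F : Finset ℕ), 0 < m →
    F ⊆ Finset.range ((encodeNat m).length - 1) → 48 ≤ F.card →
    ∃ x' : List Bool, x'.length = (encodeNat m).length ∧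
      (∀ i : ℕ, i ∉ F → x'[i]? = (encodeNat m)[i]?) ∧ decodeNat x' % 49 = 7 := by
  classical
  intro m F hm hF hcard
  obtain ⟨v, hv⟩ := exists_encodeNat_eq_append_true hm
  set e : List Bool := encodeNat m with hedef
  set n : ℕ := e.length with hndef
  have hn : n = v.length + 1 := by rw [hndef, hv, List.length_append, List.length_singleton]
  -- positions of `F` inside `Fin n`
  have hFlt : ∀ i ∈ F, i < n - 1 := fun i hi => Finset.mem_range.mp (hF hi)
  let F' : Finset (Fin n) := Finset.univ.filter fun i => (i : ℕ) ∈ F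
  have hF'card : F'.card = F.card := by
    refine Finset.card_bij (fun i _ => (i : ℕ)) (fun i hi => (Finset.mem_filter.mp hi).2)
      (fun i _ j _ h => Fin.ext h) (fun j hj => ?_)
    exact ⟨⟨j, by have := hFlt j hj; omega⟩, Finset.mem_filter.mpr ⟨Finset.mem_univ _, hj⟩, rfl⟩
  -- the fixed part of the value and the target residue
  let g₀ : Fin n → Bool := fun i => if (i : ℕ) ∈ F then false else e[(i : ℕ)]'(by omega)
  let B : ZMod 49 := ∑ i : Fin n, ((g₀ i).toNat : ZMod 49) * 2 ^ (i : ℕ)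
  have hunit : ∀ i ∈ F', IsUnit ((2 : ZMod 49) ^ ((i : Fin n) : ℕ)) := by
    intro i _
    refine IsUnit.pow _ ?_
    rw [show (2 : ZMod 49) = ((2 : ℕ) : ZMod 49) by norm_num]
    exact (ZMod.isUnit_iff_coprime 2 49).mpr (by norm_num)
  obtain ⟨S, hSF', hS⟩ := exists_subset_sum_eq_of_isUnit F' (fun i => (2 : ZMod 49) ^ (i : ℕ))
    hunit (by rw [hF'card]; omega) (7 - B)
  -- the new string
  let g : Fin n → Bool := fun i => if (i : ℕ) ∈ F then decide (i ∈ S) else e[(i : ℕ)]'(by omega)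
  refine ⟨List.ofFn g, List.length_ofFn, ?_, ?_⟩
  · intro i hi
    by_cases hin : i < n
    · rw [List.getElem?_ofFn]
      simp only [hin, ↓reduceDIte, g, hi, ↓reduceIte]
      exact (List.getElem?_eq_getElem hin).symm
    · push Not at hin
      rw [List.getElem?_eq_none (by simpa using hin), List.getElem?_eq_none (by omega)]
  · -- the top bit is untouched and `true`: the string is canonical
    have htop : g ⟨n - 1, by omega⟩ = true := by
      have hnot : n - 1 ∉ F := fun h => by have := hFlt _ h; omega
      simp only [g, hnot, ↓reduceIte]
      rw [List.getElem_eq_iff, show n - 1 = v.length by omega, hv]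
      simp
    obtain ⟨n₀, hn₀⟩ : ∃ n₀, n = n₀ + 1 := ⟨v.length, hn⟩
    have hsplit : List.ofFn g = List.ofFn (fun i : Fin n₀ => g (Fin.cast hn₀.symm i.castSucc)) ++
        [g (Fin.cast hn₀.symm (Fin.last n₀))] := ofFn_eq_append_last hn₀ g
    have hlast : g (Fin.cast hn₀.symm (Fin.last n₀)) = true := by
      rw [← htop]; congr 1; ext; simp [hn₀]
    rw [hlast] at hsplit
    rw [hsplit, decodeNat_eq_bitsToNat_append_true, ← hsplit, bitsToNat_ofFn]
    -- compute the value modulo `49`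
    suffices hmod : ((∑ i : Fin n, (g i).toNat * 2 ^ (i : ℕ) : ℕ) : ZMod 49) = ((7 : ℕ) : ZMod 49) by
      have := (ZMod.natCast_eq_natCast_iff' _ _ 49).mp hmod
      simpa using this
    push_cast
    have hsplitSum : ∑ i : Fin n, ((g i).toNat : ZMod 49) * 2 ^ (i : ℕ) =
        B + ∑ i ∈ S, (2 : ZMod 49) ^ (i : ℕ) := by
      have hS' : ∑ i ∈ S, (2 : ZMod 49) ^ (i : ℕ) =
          ∑ i : Fin n, (if i ∈ S then (2 : ZMod 49) ^ (i : ℕ) else 0) := by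
        rw [← Finset.sum_filter]; congr 1; ext i; simp
      rw [hS', ← Finset.sum_add_distrib]
      refine Finset.sum_congr rfl fun i _ => ?_
      by_cases hiF : (i : ℕ) ∈ F
      · have : (g₀ i) = false := by simp [g₀, hiF]
        rw [this]
        by_cases hiS : i ∈ S
        · simp [g, hiF, hiS]
        · simp [g, hiF, hiS]
      · have hiS : i ∉ S := fun h => hiF (Finset.mem_filter.mp (hSF' h)).2
        simp [g, g₀, hiF, hiS]
    rw [hsplitSum, hS]
    ring

end Summit.QuantumAdvantage.QuantumAdvantage.Theorems.LinnikCubicClassGroups
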